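import Mathlib
import HarnessLib

/-!
# Uniqueness for closed linear systems of ODEs with bounded solutions (iterated Grönwall)
(stub `stub_wickShellDynamic` (K6) of line `gram-pencil-harmonic-chaos`, crux `EmbeddedDrudeMourre.DrudeDissolution`,
item stmt-AtomisticToContinuum-12593; `--supports` file, closes nothing)

WHAT. An abstract uniqueness lemma for an (in general infinite) family of real functions `G i : ℝ → ℝ`,
`i : ι`, which is CLOSED UNDER DIFFERENTIATION up to a weighted bound: every `G i` is differentiable with
`|G i'(t)| ≤ Σ_k |G (τ i k) (t)|` for finitely many "successors" `τ i k`, the weights satisfy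
`Σ_k W (τ i k) ≤ L · W i`, all `G i` vanish at `0` and are uniformly bounded `|G i t| ≤ M · W i`. Then every
`G i` vanishes identically (`eq_zero_of_linear_ode_family`).

HOW. By induction on `n`, `|G i t| ≤ M · W i · (L|t|)ⁿ / n!` for all `i` (the fencing form of the mean value
inequality, `image_norm_le_of_norm_deriv_right_le_deriv_boundary`, with the polynomial fence
`B(x) = M W_i L^{n+1} x^{n+1}/(n+1)!`); then `n → ∞` (`FloorSemiring.tendsto_pow_div_factorial_atTop`).
Negative times by time reversal. This is the ODE-uniqueness step of the harmonic spectral formula (matrix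
coefficients of the thermal Koopman group on Wick monomials solve a closed linear system).
-/

noncomputable section

namespace Summit.AtomisticToContinuum.FouriersLaw.Theorems.DrudeDissolution.GramPencilHarmonicChaos

open Filter Set Topology
open scoped Nat

/-- **Iterated Grönwall bound.** If `|G i'| ≤ Σ_k |G (τ i k)|`, `Σ_k W (τ i k) ≤ L W i`, `G i 0 = 0` and
`|G i t| ≤ M W i` (`L, M ≥ 0`), then `|G i t| ≤ M W i (L t)ⁿ / n!` for every `n` and `t ≥ 0`. [folklore] -/
theorem abs_le_pow_div_factorial_of_linear_ode {ι K : Type*} [Fintype K]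
    {G G' : ι → ℝ → ℝ} {τ : ι → K → ι} {W : ι → ℝ} {L M : ℝ} (hL0 : 0 ≤ L) (hM0 : 0 ≤ M)
    (hL : ∀ i, ∑ k, W (τ i k) ≤ L * W i)
    (hderiv : ∀ i t, HasDerivAt (G i) (G' i t) t)
    (hG' : ∀ i t, |G' i t| ≤ ∑ k, |G (τ i k) t|)
    (h0 : ∀ i, G i 0 = 0) (hM : ∀ i t, |G i t| ≤ M * W i) :
    ∀ (n : ℕ) (i : ι) (t : ℝ), 0 ≤ t → |G i t| ≤ M * W i * (L * t) ^ n / n ! := by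
  intro n
  induction n with
  | zero =>
    intro i t _
    simpa using hM i t
  | succ n ih =>
    intro i t ht
    -- the polynomial fence `B x = M W_i L^{n+1} x^{n+1} / (n+1)!`
    let B : ℝ → ℝ := fun x => M * W i * L ^ (n + 1) * x ^ (n + 1) / ((n + 1)! : ℝ)
    let B' : ℝ → ℝ := fun x => M * W i * L ^ (n + 1) * x ^ n / (n ! : ℝ)
    have hBd : ∀ x, HasDerivAt B (B' x) x := by
      intro x
      have h2 := ((hasDerivAt_pow (n + 1) x).const_mul (M * W i * L ^ (n + 1))).div_const
        ((n + 1)! : ℝ)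
      refine h2.congr_deriv ?_
      show _ = M * W i * L ^ (n + 1) * x ^ n / (n ! : ℝ)
      rw [Nat.factorial_succ, Nat.add_sub_cancel]
      push_cast
      field_simp
    have hcont : ContinuousOn (G i) (Icc 0 t) :=
      fun x _ => (hderiv i x).continuousAt.continuousWithinAt
    have hder : ∀ x ∈ Ico 0 t, HasDerivWithinAt (G i) (G' i x) (Ici x) x :=
      fun x _ => (hderiv i x).hasDerivWithinAt
    have hinit : ‖G i 0‖ ≤ B 0 := by
      simp [B, h0 i]
    have hbound : ∀ x ∈ Ico 0 t, ‖G' i x‖ ≤ B' x := by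
      intro x hx
      rw [Real.norm_eq_abs]
      refine (hG' i x).trans ?_
      have hx0 : 0 ≤ x := hx.1
      calc ∑ k, |G (τ i k) x| ≤ ∑ k, M * W (τ i k) * (L * x) ^ n / n ! :=
            Finset.sum_le_sum fun k _ => ih (τ i k) x hx0
        _ = (M * (L * x) ^ n / n !) * ∑ k, W (τ i k) := by
            rw [Finset.mul_sum]
            refine Finset.sum_congr rfl fun k _ => ?_
            ring
        _ ≤ (M * (L * x) ^ n / n !) * (L * W i) := by
            refine mul_le_mul_of_nonneg_left (hL i) ?_
            positivity
        _ = B' x := by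
            simp only [B']
            ring
    have key := image_norm_le_of_norm_deriv_right_le_deriv_boundary hcont hder hinit hBd hbound
      (x := t) ⟨ht, le_rfl⟩
    rw [Real.norm_eq_abs] at key
    refine key.trans (le_of_eq ?_)
    simp only [B]
    ring

/-- **Uniqueness for closed linear ODE families, non-negative times.** Under the hypotheses of
`abs_le_pow_div_factorial_of_linear_ode`, `G i t = 0` for all `t ≥ 0`. [folklore] -/
theorem eq_zero_of_linear_ode_family_of_nonneg {ι K : Type*} [Fintype K]
    {G G' : ι → ℝ → ℝ} {τ : ι → K → ι} {W : ι → ℝ} {L M : ℝ} (hL0 : 0 ≤ L) (hM0 : 0 ≤ M)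
    (hL : ∀ i, ∑ k, W (τ i k) ≤ L * W i)
    (hderiv : ∀ i t, HasDerivAt (G i) (G' i t) t)
    (hG' : ∀ i t, |G' i t| ≤ ∑ k, |G (τ i k) t|)
    (h0 : ∀ i, G i 0 = 0) (hM : ∀ i t, |G i t| ≤ M * W i) :
    ∀ (i : ι) (t : ℝ), 0 ≤ t → G i t = 0 := by
  intro i t ht
  have hb := abs_le_pow_div_factorial_of_linear_ode hL0 hM0 hL hderiv hG' h0 hM
  have hlim : Tendsto (fun n : ℕ => M * W i * (L * t) ^ n / n !) atTop (𝓝 0) := by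
    have h := (FloorSemiring.tendsto_pow_div_factorial_atTop (L * t)).const_mul (M * W i)
    rw [mul_zero] at h
    refine h.congr' (Eventually.of_forall fun n => ?_)
    ring
  have hle : |G i t| ≤ 0 :=
    ge_of_tendsto' hlim fun n => hb n i t ht
  exact abs_eq_zero.1 (le_antisymm hle (abs_nonneg _))

/-- **Uniqueness for closed linear ODE families (iterated Grönwall).** Let `G i : ℝ → ℝ` (`i : ι`) be
differentiable with `|G i'(t)| ≤ Σ_k |G (τ i k) t|` (finitely many successors), weights `W` with
`Σ_k W (τ i k) ≤ L W i`, `G i 0 = 0` and `|G i t| ≤ M W i` uniformly. Then `G i ≡ 0` for every `i`. [folklore] -/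
theorem eq_zero_of_linear_ode_family {ι K : Type*} [Fintype K]
    {G G' : ι → ℝ → ℝ} {τ : ι → K → ι} {W : ι → ℝ} {L M : ℝ} (hL0 : 0 ≤ L) (hM0 : 0 ≤ M)
    (hL : ∀ i, ∑ k, W (τ i k) ≤ L * W i)
    (hderiv : ∀ i t, HasDerivAt (G i) (G' i t) t)
    (hG' : ∀ i t, |G' i t| ≤ ∑ k, |G (τ i k) t|)
    (h0 : ∀ i, G i 0 = 0) (hM : ∀ i t, |G i t| ≤ M * W i) :
    ∀ (i : ι) (t : ℝ), G i t = 0 := by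
  intro i t
  rcases le_total 0 t with ht | ht
  · exact eq_zero_of_linear_ode_family_of_nonneg hL0 hM0 hL hderiv hG' h0 hM i t ht
  · -- time reversal: `s ↦ G i (-s)` satisfies the same hypotheses
    have hrev := eq_zero_of_linear_ode_family_of_nonneg (G := fun i s => G i (-s))
      (G' := fun i s => -G' i (-s)) (τ := τ) hL0 hM0 hL ?_ ?_ (fun i => by simpa using h0 i)
      (fun i s => hM i (-s)) i (-t) (by linarith)
    · simpa using hrev
    · intro j s
      have h : HasDerivAt (fun s => G j (-s)) (G' j (-s) * (-1)) s :=
        (hderiv j (-s)).comp s (hasDerivAt_neg' s)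
      exact h.congr_deriv (by ring)
    · intro j s
      simpa [abs_neg] using hG' j (-s)

/-- **Uniqueness for closed linear ODE families** (`eq_zero_of_linear_ode_family` in closed `∀`-form over
`Type`, the shape registered for this helper file): bounded solutions of a closed linear system with
`Σ_k W (τ i k) ≤ L W i`, vanishing at `0`, vanish identically. [folklore] -/
theorem linear_ode_family_eq_zero :
    ∀ {ι K : Type} [Fintype K] {G G' : ι → ℝ → ℝ} {τ : ι → K → ι} {W : ι → ℝ} {L M : ℝ},
      0 ≤ L → 0 ≤ M → (∀ i, ∑ k, W (τ i k) ≤ L * W i) →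
      (∀ i t, HasDerivAt (G i) (G' i t) t) → (∀ i t, |G' i t| ≤ ∑ k, |G (τ i k) t|) →
      (∀ i, G i 0 = 0) → (∀ i t, |G i t| ≤ M * W i) → ∀ (i : ι) (t : ℝ), G i t = 0 :=
  fun hL0 hM0 hL hderiv hG' h0 hM => eq_zero_of_linear_ode_family hL0 hM0 hL hderiv hG' h0 hM

end Summit.AtomisticToContinuum.FouriersLaw.Theorems.DrudeDissolution.GramPencilHarmonicChaos

end
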